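import Mathlib

/-!
# The line bound: a fibre meets every coordinate line in at most `r` triples — for EVERY host

This work, §8.7 (l). In the coprime case with one involutory multiplier a realization of `⟨n,n,n⟩`
(CohnUmans2013, arXiv:1207.6528, Def. 12) in the translation scheme `𝒮(S⁰ × S¹, ±)` (`S¹` a finite
abelian group of odd order, `r = (|S¹|+1)/2` sign classes) consists of a flat chart `F⁰` on `[n]³` and
twisted data `a, b, c : [n]² → S¹` with

* (E)   on every triple `(i,j,k)` some sign pattern solves `a(i,j) ± b(j,k) ± c(k,i) = 0`;
* (Sep) for distinct `τ = (i,j,k)`, `τ' = (i',j',k')` in one `F⁰`-fibre, all four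
        `a(i,j) ± b(j',k) ± c(k',i') ≠ 0`.

Its rank is `r · |S⁰| ≥ r · N₀`, `N₀` the number of fibres, and Conjecture C3♯ (`rank ≥ n³`) would follow
from "average fibre size `≤ r`". Here we prove the first fibre-structure fact valid for ALL hosts `S¹`:

**Line bound.** Inside one fibre, the triples on a coordinate line — `(·, j, k)`, `(i, ·, k)` or
`(i, j, ·)` — carry pairwise *sign-distinct* values in one cell (`a(·,j)`, `a(i,·)`, resp. `c(·,i)`):
`iLine_class_ne`, `jLine_class_ne`, `kLine_class_ne`. Hence (`two_mul_card_le_of_signInjOn`) a fibre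
meets every line in at most `(|S¹|+1)/2 = r` triples (`iLine_card`, `jLine_card`, `kLine_card`, stated as
`2·#L ≤ |S¹| + 1` for groups without elements of order two).

This is tight: in the lazy twisted family (`SoloInformedTinyHostFive`, §8.7 (h)) every fibre IS an
`i`-line with exactly `r` triples, and `N₀ = n³/r`. By contrast no bound on whole fibres holds locally
for any `S¹ ≠ ℤ/3` (kit j346664/j346665, §8.7 (k)): the line bound is what survives in general.
References: this work §8.3, §8.7; CohnUmans2013 Def. 12.
-/

namespace Summit.MatrixMultiplication.MatrixMultiplication.Theorems.TwistedTPP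

namespace FibreLines

variable {ι G : Type*} [AddCommGroup G]

/-- Twisted support data over an abelian group `G` (the fixed-point-free part `S¹`, multiplier `-1`):
the three class maps and the triangle equations (E) on every triple. [this work, §8.3] -/
structure Data (ι G : Type*) [AddCommGroup G] where
  a : ι → ι → G
  b : ι → ι → G
  c : ι → ι → G
  eqn : ∀ i j k, a i j + b j k + c k i = 0 ∨ a i j + b j k - c k i = 0 ∨
    a i j - b j k + c k i = 0 ∨ a i j - b j k - c k i = 0

/-- Separation of the ordered pair `τ = (i,j,k) ← τ' = (i',j',k')`: no sign pattern solves the mixed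
equation on the cells `a(i,j)`, `b(j',k)`, `c(k',i')`. Distinct triples in one fibre are separated in
both directions. [this work, §8.3] -/
def Data.Sep (D : Data ι G) (i j k i' j' k' : ι) : Prop :=
  D.a i j + D.b j' k + D.c k' i' ≠ 0 ∧ D.a i j + D.b j' k - D.c k' i' ≠ 0 ∧
    D.a i j - D.b j' k + D.c k' i' ≠ 0 ∧ D.a i j - D.b j' k - D.c k' i' ≠ 0

/-- Core computation: if `x ± v ± w ≠ 0` for all four patterns while `y ± v ± w = 0` for some pattern,
then `x ≠ y` and `x ≠ -y`. [this work, §8.7 (l)] -/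
theorem ne_and_ne_neg_of_sep {x y v w : G}
    (hx : x + v + w ≠ 0 ∧ x + v - w ≠ 0 ∧ x - v + w ≠ 0 ∧ x - v - w ≠ 0)
    (hy : y + v + w = 0 ∨ y + v - w = 0 ∨ y - v + w = 0 ∨ y - v - w = 0) :
    x ≠ y ∧ x ≠ -y := by
  obtain ⟨h₁, h₂, h₃, h₄⟩ := hx
  refine ⟨?_, ?_⟩
  · rintro rfl
    rcases hy with h | h | h | h
    · exact h₁ h
    · exact h₂ h
    · exact h₃ h
    · exact h₄ h
  · rintro rfl
    rcases hy with h | h | h | h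
    · apply h₄
      have : -y - v - w = -(y + v + w) := by abel
      rw [this, h, neg_zero]
    · apply h₃
      have : -y - v + w = -(y + v - w) := by abel
      rw [this, h, neg_zero]
    · apply h₂
      have : -y + v - w = -(y - v + w) := by abel
      rw [this, h, neg_zero]
    · apply h₁
      have : -y + v + w = -(y - v - w) := by abel
      rw [this, h, neg_zero]

/-- **`i`-lines.** If `(i,j,k)` and `(i',j,k)` are separated then `a(i,j)` and `a(i',j)` are
sign-distinct: `a(i,j) ≠ ± a(i',j)`. [(E) at `(i',j,k)` uses the same cells `b(j,k)`, `c(k,i')`.]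
[this work, §8.7 (l)] -/
theorem iLine_class_ne (D : Data ι G) {i i' j k : ι} (h : D.Sep i j k i' j k) :
    D.a i j ≠ D.a i' j ∧ D.a i j ≠ -D.a i' j :=
  ne_and_ne_neg_of_sep h (D.eqn i' j k)

/-- **`j`-lines.** If `(i,j,k)` and `(i,j',k)` are separated then `a(i,j) ≠ ± a(i,j')`.
[(E) at `(i,j',k)` uses the cells `b(j',k)`, `c(k,i)`.] [this work, §8.7 (l)] -/
theorem jLine_class_ne (D : Data ι G) {i j j' k : ι} (h : D.Sep i j k i j' k) :
    D.a i j ≠ D.a i j' ∧ D.a i j ≠ -D.a i j' :=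
  ne_and_ne_neg_of_sep h (D.eqn i j' k)

/-- **`k`-lines.** If `(i,j,k)` and `(i,j,k')` are separated then `c(k',i) ≠ ± c(k,i)`.
[(E) at `(i,j,k)` uses the cells `a(i,j)`, `b(j,k)`.] [this work, §8.7 (l)] -/
theorem kLine_class_ne (D : Data ι G) {i j k k' : ι} (h : D.Sep i j k i j k') :
    D.c k' i ≠ D.c k i ∧ D.c k' i ≠ -D.c k i := by
  obtain ⟨h₁, h₂, h₃, h₄⟩ := h
  refine ⟨?_, ?_⟩
  · intro e
    rw [e] at h₁ h₂ h₃ h₄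
    rcases D.eqn i j k with h | h | h | h
    · exact h₁ h
    · exact h₂ h
    · exact h₃ h
    · exact h₄ h
  · intro e
    rw [e] at h₁ h₂ h₃ h₄
    rcases D.eqn i j k with h | h | h | h
    · apply h₂
      rw [sub_neg_eq_add, h]
    · apply h₁
      rw [← sub_eq_add_neg, h]
    · apply h₄
      rw [sub_neg_eq_add, h]
    · apply h₃
      rw [← sub_eq_add_neg, h]

/-- Counting: a map that is *sign-injective* on a finite set `L` (distinct points have values that are
neither equal nor opposite) into a group without elements of order two satisfies `2·#L ≤ |G| + 1`
(the image `A` has `A ∩ (-A) ⊆ {0}`). For `|G| = q` odd this is `#L ≤ (q+1)/2 = r`, the number of sign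
classes. [this work, §8.7 (l)] -/
theorem two_mul_card_le_of_signInjOn [Fintype G] [DecidableEq G] (hG : ∀ x : G, x = -x → x = 0)
    (φ : ι → G) (L : Finset ι)
    (h : ∀ u ∈ L, ∀ v ∈ L, u ≠ v → φ u ≠ φ v ∧ φ u ≠ -φ v) :
    2 * L.card ≤ Fintype.card G + 1 := by
  classical
  set A : Finset G := L.image φ with hA
  set B : Finset G := A.image (fun x => -x) with hB
  have hinj : Set.InjOn φ L := by
    intro u hu v hv e
    by_contra hne
    exact (h u hu v hv hne).1 e
  have hAcard : A.card = L.card := Finset.card_image_of_injOn hinj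
  have hBcard : B.card = A.card :=
    Finset.card_image_of_injective _ neg_injective
  have hinter : (A ∩ B).card ≤ 1 := by
    apply Finset.card_le_one.mpr
    -- every element of `A ∩ B` is `0`
    have h0 : ∀ x ∈ A ∩ B, x = 0 := by
      intro x hx
      rw [Finset.mem_inter] at hx
      obtain ⟨hxA, hxB⟩ := hx
      rw [hB, Finset.mem_image] at hxB
      obtain ⟨y, hyA, rfl⟩ := hxB
      rw [hA, Finset.mem_image] at hxA hyA
      obtain ⟨u, hu, hu'⟩ := hxA
      obtain ⟨v, hv, rfl⟩ := hyA
      by_cases huv : u = v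
      · rw [huv] at hu'
        have : φ v = 0 := hG _ hu'
        rw [this, neg_zero]
      · exact absurd hu' (h u hu v hv huv).2
    intro x hx y hy
    rw [h0 x hx, h0 y hy]
  have hunion : (A ∪ B).card ≤ Fintype.card G := Finset.card_le_univ _
  have := Finset.card_union_add_card_inter A B
  omega

/-- **Line bound, `i`-direction.** If the triples `(i,j,k)`, `i ∈ L`, are pairwise separated (as they are
inside one fibre) then `2·#L ≤ |S¹| + 1`, i.e. `#L ≤ r`. Tight for the lazy twisted family, whose
fibres are `i`-lines of size exactly `r`. [this work, §8.7 (l)] -/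
theorem iLine_card [Fintype G] [DecidableEq G] (hG : ∀ x : G, x = -x → x = 0) (D : Data ι G) (j k : ι) (L : Finset ι)
    (h : ∀ i ∈ L, ∀ i' ∈ L, i ≠ i' → D.Sep i j k i' j k) :
    2 * L.card ≤ Fintype.card G + 1 :=
  two_mul_card_le_of_signInjOn hG (fun i => D.a i j) L
    (fun u hu v hv huv => iLine_class_ne D (h u hu v hv huv))

/-- **Line bound, `j`-direction.** [this work, §8.7 (l)] -/
theorem jLine_card [Fintype G] [DecidableEq G] (hG : ∀ x : G, x = -x → x = 0) (D : Data ι G) (i k : ι) (L : Finset ι)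
    (h : ∀ j ∈ L, ∀ j' ∈ L, j ≠ j' → D.Sep i j k i j' k) :
    2 * L.card ≤ Fintype.card G + 1 :=
  two_mul_card_le_of_signInjOn hG (fun j => D.a i j) L
    (fun u hu v hv huv => jLine_class_ne D (h u hu v hv huv))

/-- **Line bound, `k`-direction.** [this work, §8.7 (l)] -/
theorem kLine_card [Fintype G] [DecidableEq G] (hG : ∀ x : G, x = -x → x = 0) (D : Data ι G) (i j : ι) (L : Finset ι)
    (h : ∀ k ∈ L, ∀ k' ∈ L, k ≠ k' → D.Sep i j k i j k') :
    2 * L.card ≤ Fintype.card G + 1 :=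
  two_mul_card_le_of_signInjOn hG (fun k => D.c k i) L
    (fun u hu v hv huv => by
      have := kLine_class_ne D (h v hv u hu (Ne.symm huv))
      exact ⟨this.1, this.2⟩)

/-- In a finite abelian group of odd order no nonzero element is its own negative, so the line bounds
apply to every fixed-point-free part `S¹` of a coprime `m = 2` scheme. [standard] -/
theorem eq_zero_of_eq_neg_of_card_odd [Fintype G] (hodd : Odd (Fintype.card G)) (x : G) (hx : x = -x) : x = 0 := by
  have h2 : 2 • x = 0 := by
    rw [two_nsmul]
    nth_rewrite 2 [hx]
    exact add_neg_cancel x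
  have hord : addOrderOf x ∣ 2 := addOrderOf_dvd_of_nsmul_eq_zero h2
  have hcard : addOrderOf x ∣ Fintype.card G := addOrderOf_dvd_card
  have hcop : Nat.Coprime 2 (Fintype.card G) := Nat.coprime_two_left.2 hodd
  have h1 : addOrderOf x ∣ 1 := by
    have h := Nat.dvd_gcd hord hcard
    rwa [hcop.gcd_eq_one] at h
  exact AddMonoid.addOrderOf_eq_one_iff.mp (Nat.dvd_one.mp h1)

/-- **Line bound for odd hosts** (the form used in §8.7 (l)): `S¹` of odd order, triples `(i,j,k)`,
`i ∈ L`, pairwise separated ⟹ `2·#L ≤ |S¹| + 1`. [this work, §8.7 (l)] -/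
theorem iLine_card_odd [Fintype G] [DecidableEq G] (hodd : Odd (Fintype.card G)) (D : Data ι G) (j k : ι) (L : Finset ι)
    (h : ∀ i ∈ L, ∀ i' ∈ L, i ≠ i' → D.Sep i j k i' j k) :
    2 * L.card ≤ Fintype.card G + 1 :=
  iLine_card (eq_zero_of_eq_neg_of_card_odd hodd) D j k L h

end FibreLines

end Summit.MatrixMultiplication.MatrixMultiplication.Theorems.TwistedTPP
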